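import Literature.AlgebraicGeometry.Hyperkaehler.KugaSatakeCorrespondenceHyperkaehler
import Literature.AlgebraicGeometry.Hyperkaehler.IrreducibleSymplecticOddCohomology
import HarnessLib

/-!
# The third cohomology of a hyper-Kähler manifold and the Kuga–Satake variety: the O'Grady map, the Kuga–Satake factor of `J³(X)`, and `KS ~ J³(X)⁴` for Kummer type (Voisin 2022 Thm. 2.1, Thm. 1.3 (2), Thm. 3.2 = O'Grady 2021 Thm. 1.5) — NAMED FACTS

Layer `Literature/AlgebraicGeometry/Hyperkaehler`.  Second file of the cross-ladder literature-typing
tranche LT-H4 (HodgeAV ladder, rungs H2/H3 ideation inputs; cell `pub/vhodge/lit-oqh`, seat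
`hodge-lit-oqh-1`) on

* C. Voisin, *Footnotes to papers of O'Grady and Markman*, Math. Z. 300 (2022) 3405–3416
  = arXiv:2106.06979 [`Voisin2022FootnotesOGradyMarkman`; **REFEREED**; held text
  `paper:arxiv-2106.06979`, locators `pNNNN:Lnn` = chunk:line of that materialisation],

companion of `IrreducibleSymplecticOddCohomology` (Cor. 2.4, Lemma 2.5, Thm. 3.3, Thm. 3.4, Cor. 3.5),
which recorded as NOT typable at the time (no carrier): Thm. 2.1 (needs the dual Beauville–Bogomolov class
`Q_X ∈ H⁴`), Thm. 1.3 (2) / Thm. 3.2 (need a Kuga–Satake structure for `2n`-folds) and §4 (needs "the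
Kuga–Satake correspondence is algebraic" for `2n`-folds).  The carriers have since landed (seat
`hodge-lit-oqh-2`): `Hyperkaehler.IsFujikiForm` (file `KummerTypeHodgeSimilitudes`: the Beauville–Bogomolov
form on `H²(X(ℂ); ℂ)` up to the scalar `ℂˣ`, pinned by Fujiki's relation), `Hyperkaehler.IsTranscendentalPartHK`
and `Hyperkaehler.IsKSCorrespondenceAlgebraicHK` (file `KugaSatakeCorrespondenceHyperkaehler`: a
presentation `(T, H, P, j)` of `(H²_tr(X, ℚ), q_X)` and Floccari's "Kuga–Satake Hodge conjecture for `X`"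
as a per-`X` property), on top of the tree's van Geemen Kuga–Satake structure
`Motives.HodgeStructure.kugaSatake H P hT` (weight `1` on `C⁺(P)`, file `Motives/KugaSatake`), its
sub-Hodge structures / irreducibility / Tate twists / finite direct sums (`SubHodgeStructure`,
`IsIrreducible`, `tateTwist`, `cast`, `pi`).  This file types three of the four remaining results ON THOSE
CARRIERS — the fourth, §4 / Thm. 4.1 = Thm. 1.5 ("the Kuga-Satake correspondence of a projective `Kumⁿ`-type
`X` is algebraic"), was typed concurrently by seat `hodge-lit-oqh-2` as
`Hyperkaehler.Voisin2022_kugaSatakeCorrespondence_algebraic_kummerType` (file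
`KummerTypeKugaSatakeCorrespondence`: `IsKSCorrespondenceAlgebraicHK n hX` for every projective `Kumⁿ`,
`n ≥ 2`) and is CITED BY NAME here, not retyped; nothing new is defined except the two-line recursion `cupPowFour` (`x ↦ xⁱ` for a degree-`4`
class, twin of `HodgeTheory.cupPowTwo`) and the dual Beauville–Bogomolov class `bbDualClass`
(`Σᵢ eᵢ ∪ eⁱ` for `b`-dual bases, Voisin's `Q_X`).

## Sources, verbatim

* Voisin §2.1 (p0005:L5–L13): "Let `X` be a hyper-Kähler manifold of dimension `2n` with `n ≥ 2`. The
  Beauville-Bogomolov quadratic form `q_X` is a nondegenerate quadratic form on `H²(X,ℚ)`, whose inverse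
  gives an element of `Sym²H²(X,ℚ)`. By Verbitsky, the later space imbeds by cup-product in `H⁴(X,ℚ)`,
  hence we get a class `Q_X ∈ H⁴(X,ℚ)`.  The O'Grady map `φ : ⋀²H³(X,ℚ) → H^{4n-2}(X,ℚ)` is defined by
  `φ(α ∧ β) = Q_X^{n-2} ∪ α ∪ β`."  **Thm. 2.1** (p0005:L17–L18; = Thm. 1.3 (1), p0003:L37–L44): "Let `X`
  be a hyper-Kähler manifold of dimension `2n`. Assume `H³(X,ℚ) ≠ 0`. Then the O'Grady map
  `φ : ⋀²H³(X,ℚ) → H^{4n-2}(X,ℚ)` is surjective."  (Proof, p0005:L20–L57: deform to a very general complex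
  structure, where `H^{4n-2}(X,ℚ)` is a simple Hodge structure, and show `φ ≠ 0` from the hard Lefschetz
  theorem and the representation theory of `O(q_X)` on `Sym^{2n-3}H²` — the statement is topological, hence
  holds throughout the deformation class.)
* **Thm. 1.3 (2)** (p0003:L37, L46–L47): "Let `X` be a hyper-Kähler `2n`-fold such that `b₃(X) ≠ 0`. Then
  […] (2) Assuming `X` is projective, the intermediate Jacobian `J³(X)` contains a simple component of the
  Kuga-Satake abelian variety of `H²(X,ℚ)_tr`."  With p0004:L3: "the points (2) and (3) follow, using this
  observation [`H³` has Hodge level `1`], from the point (1), and from a universality property for the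
  Kuga-Satake weight `1` Hodge structure, proved by Charles", §3 p0008:L5: "The Kuga-Satake Hodge structure
  `H¹_{KS+}` [on the even Clifford algebra `C⁺(H², ( , ))`, p0007:L36] is then polarized and thus is the
  weight `1` Hodge structure on the degree `1` rational cohomology of an abelian variety, that we will
  denote `KS(H²,( , ))`, and is defined up to isogeny", and §4 p0010:L54–L56: "`J³(X)` is the complex torus
  `H³(X,ℂ)/(F²H³(X,ℂ) ⊕ H³(X,ℤ))` […] so that `H₁(J³(X),ℤ) = H³(X,ℤ)` canonically."  Charles' universality
  theorem (F. Charles, Math. Z. 300 (2022) 3623–3643 [`Charles2022HodgeStructureComplexTori`; REFEREED], §1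
  p0003:L27 and Thm. 4.4, held text `paper:arxiv-2106.11069`) is stated "if `V` is general enough", i.e.
  under "Assume that the Mumford-Tate group of the Hodge structure `V` is the full special orthogonal group
  `SO(V)`" (p0009): the printed proof route of (2) runs at a Mumford–Tate-general point of the polarised
  deformation space of `X`; the printed STATEMENT is for every projective `X` with `b₃ ≠ 0` (the passage
  to an arbitrary projective `X` is the standard specialisation of Hodge classes in
  `Hom(H₁(KS_t), H₁(J³(X_t)))` along the polarised family, not spelled out in print).  Rendered as printed.
* **Thm. 3.2** (p0008:L23–L26; = Thm. 1.1 (2), p0003:L8, attributed to O'Grady): "The intermediate Jacobian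
  `J³(X)` of a projective hyper-Kähler manifold of generalized Kummer deformation type with `ρ(X) = 1` is a
  Weil abelian fourfold. The Kuga-Satake variety of `(H²(X,ℚ)_tr, q_X)` is isogenous to a sum of two copies
  of `J³(X)`."  PRIMARY SOURCE: K. G. O'Grady, IMRN 2021 (arXiv:1805.12075) [`OGrady2021KummerTori`;
  REFEREED], **Thm. 1.5**, last sentence (held text `paper:arxiv-1805.12075` p0003:L74): "Moreover, th[e]
  Kuga-Satake variety `KS(X,L)` is isogenous to `J³(X)⁴`" (`KS(X,L)` built from `H²(X)_pr`, p0002:L10–L14;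
  for `ρ(X) = 1`, `H²_pr = H²_tr` of rank `6`), restated by Floccari, Compos. Math. 160 (2024) §5.2
  (held text `paper:arxiv-2210.02948` p0017:L63–L65): "For the general projective variety `K` of
  `Kum³`-type, `H²_tr(K,ℚ)` is a rank `6` Hodge structure with Hodge numbers `(1, 4, 1)` and the explicit
  knowledge of the quadratic form allows one to show that the Kuga Satake variety is `A⁴`, where `A` is an
  abelian fourfold of Weil type (cf. [vanGeemen]). O'Grady moreover shows in [O'G21] that
  `H¹(A,ℚ) ≅ H³(K,ℚ)`."  LOCATED DISCREPANCY (recorded, not adjudicated beyond the count): Voisin's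
  restatement says "two copies", O'Grady's theorem and Floccari's restatement say the FOURTH power; the
  dimension count `dim_ℚ C⁺(ℚ⁶) = 2⁵ = 32 = 4 · b₃(X)` (`b₃ = 8`, p0003:L3) is that of the fourth power,
  which is what is typed (O'Grady's exponent; Voisin Thm. 3.2 cited as the secondary statement).
## Rendering (tree carriers) and faithfulness

* "hyper-Kähler manifold of dimension `2n`" ↦ `IsProjectiveIrreducibleSymplectic (2 * n) X` — the PROJECTIVE
  case, WEAKER than print for Thm. 2.1 (print: all compact hyper-Kähler), equal to print for Thm. 1.3 (2)
  ("Assuming `X` is projective"); "of generalized Kummer (deformation) type, `n ≥ 2`" ↦ `2 ≤ n`,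
  `IsSmoothProjective (2 * n) X`, `IsOfGeneralizedKummerType n X` (as in every `Kumⁿ` record of this layer).
* `q_X` ↦ a Fujiki form `b` (`IsFujikiForm n X b`; classically `b = λ · (q_X ⊗ ℂ)`, `λ ∈ ℂˣ`).  Voisin's
  `Q_X = cup(q_X⁻¹)`: for a basis `(eᵢ)` of `H²(X(ℂ); ℂ)` and its `b`-DUAL family `(eⁱ)`
  (`b(eᵢ, eʲ) = δᵢⱼ`), `Q_b := Σᵢ eᵢ ∪ eⁱ ∈ H⁴(X(ℂ); ℂ)` (`bbDualClass`); `Σᵢ eᵢ ⊗ eⁱ` is the inverse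
  tensor of `b`, so `Q_b = λ⁻¹ · (Q_X ⊗ 1)`, independent of the basis, and the O'Grady maps of `Q_b` and
  `Q_X` have the same image (`λ ≠ 0`).  The statement quantifies over ALL bases and dual families (all give
  the same class; for a degenerate `b` no dual family exists and nothing is claimed — Fujiki forms of a
  hyper-Kähler manifold are non-degenerate, Beauville 1983 Thm. 5).
* `Q^{n-2} ∪ α ∪ β`, `α, β ∈ H³` ↦ `cupProduct _ (cupPowFour Q (n - 2)) (cupProduct _ α β)` in degree
  `4(n-2) + (3+3)` (`= 4n - 2` for `n ≥ 2`; the literal sum is the cup product's own target degree, so the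
  statement carries no cast); "surjective onto `H^{4n-2}(X,ℚ)`" ↦ the `ℂ`-span of these classes is `⊤`
  (surjectivity of a `ℚ`-bilinear map's span ⟺ that of its complexification).
* "the Kuga-Satake abelian variety of `H²(X,ℚ)_tr`" ↦ the tree's weight-one structure
  `H.kugaSatake P hT` on `C⁺(P)` for ANY presentation `(T, H, P, j)` of `(H²_tr(X, ℚ), q_X)` relative to a
  Fujiki form and a Hodge-symmetric Hodge model `M` (`IsTranscendentalPartHK hX M hM b H P j`,
  `hT : h^{2,0}(T) = 1`) — all presentations are isomorphic (`j` is an isomorphism onto `H²_tr`, `P` is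
  pinned), so the `∀` is immaterial; Voisin's `KS(H², ( , ))` IS the abelian variety with
  `H¹ = H¹_{KS+} = C⁺` (p0008:L5), van Geemen's convention = the tree's.  "a simple component `S` of `KS`"
  ↦ an IRREDUCIBLE sub-Hodge structure `W` of `H.kugaSatake P hT` (`W = H¹(S, ℚ)`; simple abelian
  subvarieties up to isogeny ⟷ irreducible sub-Hodge structures of `H¹`, Poincaré reducibility + Riemann);
  "`J³(X)` contains `S`" ↦ an INJECTIVE morphism of Hodge structures `W → H³(X, ℚ)(1)`: by p0010:L54–L56,
  `H₁(J³(X), ℚ) = H³(X, ℚ)(2)` (types `(2,1), (1,2) ↦ (0,-1), (-1,0)`), so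
  `H¹(J³(X), ℚ) = H³(X, ℚ)(2)^∨ ≅ H³(X, ℚ)(1)` by a polarisation, and `S ↪ J³(X)` up to isogeny ⟺
  `H₁(S) ↪ H₁(J³X)` ⟺ `H¹(S) ↪ H¹(J³X)` (semisimplicity) ⟺ `W ↪ H³(X, ℚ)(1)`.  Here `H³(X, ℚ)` carries
  the weight-`3` structure `M.hodgeStructure hX hM 3` of the model (`HodgeTheory/HodgeStructureOfHodgeModel`;
  all models agree) and `(·)(1)` is `HodgeStructure.tateTwist 1`, transported to the literal weight `1`.
* "`KS(H²_tr, q_X)` is isogenous to `J³(X)⁴`" (`ρ(X) = 1`) ↦ a `ℚ`-linear isomorphism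
  `θ : C⁺(P) ≃ (Fin 4 → H³(X(ℂ); ℚ))` carrying the Kuga–Satake filtration onto that of the direct sum
  `HodgeStructure.pi` of four copies of `H³(X, ℚ)(1)` (an isomorphism of rational Hodge structures
  `H¹(KS) ≅ H¹(J³(X)⁴)`; the pattern of `HodgeTheory.IsKugaSatakeVarietyBetti`); "`ρ(X) = 1`" ↦
  `dim_ℚ T = 6` (`b₂(Kumⁿ) = 7`, p0003:L3, so `rank H²_tr = 6 ⟺ ρ = 1`).

## Content and accounting (D-0026: +3 named facts, each a REFEREED published theorem cited at the line)

* definitions `cupPowFour`, `bbDualClass`, `bettiThreeTwistOne` (plumbing, with unfolding lemmas);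
* facts `Voisin2022_ogradyMap_surjective` (Thm. 2.1), `Voisin2022_thirdCohomology_kugaSatakeFactor`
  (Thm. 1.3 (2)), `OGrady2021_kugaSatake_kummerType_fourthPower_thirdCohomology` (O'Grady Thm. 1.5 =
  Voisin Thm. 3.2 / Thm. 1.1 (2));
* kernel: the `b₃ = 8` (`Kumⁿ`) spelling of Thm. 1.3 (2), the ladder's "sixfold host" reading of
  Thm. 1.3 (2)–(3), and the numerical identity `2^(6-1) = 4 · 8` behind the exponent `4`.

`b₃ = 0` (K3^[n], OG6, OG10: `OGradySixReference.finrank_complexBetti_odd`): the hypotheses `b₃ ≠ 0` of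
Thm. 2.1 / Thm. 1.3 (2) fail and nothing is claimed there (the zero abelian variety `J³(X) = 0` contains no
simple component — the statements are genuinely about the deformation types with odd cohomology, of which
`Kumⁿ` is the only known one).

Deliberately NOT here: Thm. 4.1 (typed by seat `hodge-lit-oqh-2`, above); Prop. 2.2 / Prop. 2.3
(non-vanishing statements subsumed by Thm. 2.1 / not propositions about a fixed target); Charles' universality theorem itself (its
Mumford–Tate hypothesis has no carrier on these structures); the conjectural statements (they are typed on
the summit side: `Summits/HodgeConjecture/HodgeConjecture/Theorems/OpenQuestionsVoisin2022.lean`,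
`…/OpenQuestionsFloccari.lean`, staged).  Nothing here asserts HC / HC_AV / any Weil-class statement; typed
≠ proved ≠ endorsed.
-/

noncomputable section

open CategoryTheory
open scoped TensorProduct

namespace Literature.AlgebraicGeometry.Hyperkaehler

open Literature.AlgebraicTopology.SingularHomology
open Literature.AlgebraicGeometry.HodgeTheory
open Motives (SchemeOver IsSmoothProjective bettiCohomology HodgeStructure)

/-! ## The dual Beauville–Bogomolov class `Q_X ∈ H⁴` and powers of a degree-`4` class -/

/-- `4i + 4 = 4(i + 1)`: the degree equation of the recursion `xⁱ⁺¹ = xⁱ ∪ x` for a degree-`4` class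
(the grading of the cup product, Hatcher §3.2; twin of `HodgeTheory.two_mul_add_two`). [cite: HatcherAT2002, §3.2 (the cup product Hᵏ × Hˡ → Hᵏ⁺ˡ)] -/
theorem four_mul_add_four (i : ℕ) : 4 * i + 4 = 4 * (i + 1) := rfl

/-- The **`i`-th cup power `xⁱ ∈ H⁴ⁱ(Y; ℂ)` of a degree-`4` class** `x ∈ H⁴(Y; ℂ)`: `x⁰ = 1`,
`xⁱ⁺¹ = xⁱ ∪ x` (Hatcher §3.2) — the degree-`4` twin of `HodgeTheory.cupPowTwo`, landing in `H^{4·i}`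
definitionally (Voisin's `Q_X^{n-2} ∈ H^{4n-8}`). [cite: HatcherAT2002, §3.2] -/
def cupPowFour {Y : Type} [TopologicalSpace Y] (x : singularCohomology ℂ ℂ Y 4) :
    (i : ℕ) → singularCohomology ℂ ℂ Y (4 * i)
  | 0 => singularCohomology.one ℂ Y
  | i + 1 => cupProduct (four_mul_add_four i) (cupPowFour x i) x

/-- `x⁰ = 1`. [cite: HatcherAT2002, §3.2] -/
@[simp]
theorem cupPowFour_zero {Y : Type} [TopologicalSpace Y] (x : singularCohomology ℂ ℂ Y 4) :
    cupPowFour x 0 = singularCohomology.one ℂ Y := rfl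

/-- `xⁱ⁺¹ = xⁱ ∪ x`. [cite: HatcherAT2002, §3.2] -/
theorem cupPowFour_succ {Y : Type} [TopologicalSpace Y] (x : singularCohomology ℂ ℂ Y 4) (i : ℕ) :
    cupPowFour x (i + 1) = cupProduct (four_mul_add_four i) (cupPowFour x i) x := rfl

/-- **The dual Beauville–Bogomolov class** `Q_b := Σᵢ eᵢ ∪ eⁱ ∈ H⁴(X(ℂ); ℂ)` attached to a family
`e : ι → H²(X(ℂ); ℂ)` and a second family `e' : ι → H²(X(ℂ); ℂ)` — intended: `e` a basis and `e'` its
dual family for a (non-degenerate, symmetric) form `b` (`b(eᵢ, e'ⱼ) = δᵢⱼ`), in which case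
`Σᵢ eᵢ ⊗ e'ᵢ ∈ Sym²H²` is the inverse tensor of `b` and `Q_b` is its image under the cup product
(Voisin §2.1, p0005:L5–L8: "`q_X` is a nondegenerate quadratic form on `H²(X,ℚ)`, whose inverse gives an
element of `Sym²H²(X,ℚ)` [… which] imbeds by cup-product in `H⁴(X,ℚ)`, hence we get a class
`Q_X ∈ H⁴(X,ℚ)`").  For `b = λ · (q_X ⊗ ℂ)`: `Q_b = λ⁻¹ · (Q_X ⊗ 1)`, independent of the basis.
[cite: Voisin2022FootnotesOGradyMarkman, §2.1 (arXiv:2106.06979 p. 4, the class Q_X)] -/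
def bbDualClass {X : SchemeOver ℂ} {ι : Type} [Fintype ι] (e e' : ι → complexBetti X 2) :
    complexBetti X 4 :=
  ∑ i, cupProduct (show 2 + 2 = 4 from rfl) (e i) (e' i)

/-- Unfolding lemma. [cite: Voisin2022FootnotesOGradyMarkman, §2.1] -/
theorem bbDualClass_def {X : SchemeOver ℂ} {ι : Type} [Fintype ι] (e e' : ι → complexBetti X 2) :
    bbDualClass e e' = ∑ i, cupProduct (show 2 + 2 = 4 from rfl) (e i) (e' i) := rfl

/-! ## Thm. 2.1 — the O'Grady map is surjective for every hyper-Kähler manifold with `b₃ ≠ 0` -/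

/-- **Voisin 2022, Thm. 2.1 (= Thm. 1.3 (1); REFEREED): "Let `X` be a hyper-Kähler manifold of
dimension `2n`. Assume `H³(X,ℚ) ≠ 0`. Then the O'Grady map `φ : ⋀²H³(X,ℚ) → H^{4n-2}(X,ℚ)`,
`φ(α ∧ β) = Q_X^{n-2} ∪ α ∪ β`, is surjective"** (first proved by O'Grady for generalized Kummer type,
p0005:L15).  Rendering (module docstring): for `2 ≤ n`, `X` a PROJECTIVE irreducible symplectic variety
of dimension `2n` with `b₃(X) ≠ 0`, every Fujiki form `b`, every basis `e` of `H²(X(ℂ); ℂ)` and every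
`b`-dual family `e'` (`b(eᵢ, e'ⱼ) = δᵢⱼ`), the `ℂ`-span of the classes `Q_b^{n-2} ∪ (α ∪ β)`,
`α, β ∈ H³(X(ℂ); ℂ)`, `Q_b = bbDualClass e e'`, is all of `H^{4(n-2)+(3+3)}(X(ℂ); ℂ) = H^{4n-2}(X(ℂ); ℂ)`.
Projective case of the printed (compact hyper-Kähler) statement — weaker than print.  A published THEOREM
recorded as a named fact. [cite: Voisin2022FootnotesOGradyMarkman, Thm. 2.1 (§2.1; arXiv:2106.06979 p. 4) and Thm. 1.3 (1)]
[cite: OGrady2021KummerTori, Thm. 1.1 (1) (the Kummer-type case)] -/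
def Voisin2022_ogradyMap_surjective : Prop :=
  ∀ (n : ℕ) (_ : 2 ≤ n) (X : SchemeOver ℂ), IsProjectiveIrreducibleSymplectic (2 * n) X →
    Module.finrank ℂ (complexBetti X 3) ≠ 0 →
  ∀ (b : complexBetti X 2 →ₗ[ℂ] complexBetti X 2 →ₗ[ℂ] ℂ), IsFujikiForm n X b →
  ∀ (ι : Type) [Fintype ι] [DecidableEq ι] (e : Module.Basis ι ℂ (complexBetti X 2))
    (e' : ι → complexBetti X 2), (∀ i j, b (e i) (e' j) = if i = j then 1 else 0) →
      Submodule.span ℂ (Set.range fun αβ : complexBetti X 3 × complexBetti X 3 ↦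
        cupProduct (rfl : 4 * (n - 2) + (3 + 3) = 4 * (n - 2) + (3 + 3))
          (cupPowFour (bbDualClass e e') (n - 2))
          (cupProduct (rfl : 3 + 3 = 3 + 3) αβ.1 αβ.2)) = ⊤

/-! ## Thm. 1.3 (2) — `J³(X)` contains a simple factor of the Kuga–Satake variety of `H²_tr` -/

/-- **The weight-one Hodge structure `H³(X, ℚ)(1)`** of a smooth projective `X` read through a
Hodge-symmetric Hodge model `M`: the Tate twist by `1` of `M.hodgeStructure hX hM 3`, transported to the
literal weight `1` (`F¹ = F²H³ ⊇ H^{3,0} ⊕ H^{2,1}`).  For a hyper-Kähler `X` (`H^{3,0} = 0`) this is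
`H¹(J³(X), ℚ)` up to the polarisation isomorphism (module docstring; Voisin §4: "`H₁(J³(X),ℤ) = H³(X,ℤ)`
canonically"). [cite: Voisin2022FootnotesOGradyMarkman, §4 (arXiv:2106.06979 p. 10, the torus J³(X))]
[cite: DeligneHodgeII1971, 2.1.13 (Tate twist)] -/
abbrev bettiThreeTwistOne {n : ℕ} {X : SchemeOver ℂ} (hX : IsSmoothProjective (2 * n) X)
    (M : HodgeModel (2 * n) X) (hM : M.IsHodgeSymmetric) : HodgeStructure (bettiCohomology X 3) 1 :=
  ((M.hodgeStructure hX hM 3).tateTwist 1).cast (by norm_num)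

/-- **Voisin 2022, Thm. 1.3 (2) (REFEREED): "Let `X` be a hyper-Kähler `2n`-fold such that `b₃(X) ≠ 0`.
Then […] (2) Assuming `X` is projective, the intermediate Jacobian `J³(X)` contains a simple component
of the Kuga-Satake abelian variety of `H²(X,ℚ)_tr`."**  Rendering (module docstring): for `X` a
projective irreducible symplectic variety of dimension `2n` with `b₃(X) ≠ 0`, every Fujiki form `b`,
every Hodge-symmetric Hodge model `M`, and every presentation `(T, H, P, j)` of `(H²_tr(X, ℚ), q_X)` with
`h^{2,0}(T) = 1` (`IsTranscendentalPartHK`), there is an IRREDUCIBLE sub-Hodge structure `W` of the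
Kuga–Satake structure `H.kugaSatake P hT` on `C⁺(P)` (`W = H¹` of a simple component of
`KS(H²_tr, q_X)`) together with an INJECTIVE morphism of weight-one Hodge structures
`W → H³(X, ℚ)(1) = H¹(J³(X), ℚ)` (`bettiThreeTwistOne`).  Proof in print: Thm. 2.1 gives an injective
morphism of Hodge structures `H²(X,ℚ) ↪ ⋀²H³(X,ℚ)^*` (proof of Thm. 3.3, p0008:L41–L47); `H³` has Hodge
level `1`, and Charles' universality of the Kuga–Satake structure applies at a Mumford–Tate-general point
— see the module docstring for the scope of that route versus the printed statement, which is what is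
rendered (every projective `X`).  A published THEOREM recorded as a named fact.
[cite: Voisin2022FootnotesOGradyMarkman, Thm. 1.3 (2) (§1, arXiv:2106.06979 p. 2) with §3 (KS(H²,( , )), p. 7) and §4 (J³(X), p. 10)]
[cite: Charles2022HodgeStructureComplexTori, §1 and Thm. 4.4 (universality of the Kuga–Satake construction, "V general enough")] -/
def Voisin2022_thirdCohomology_kugaSatakeFactor : Prop :=
  ∀ (n : ℕ) (X : SchemeOver ℂ) (hX : IsProjectiveIrreducibleSymplectic (2 * n) X),
    Module.finrank ℂ (complexBetti X 3) ≠ 0 →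
  ∀ (b : complexBetti X 2 →ₗ[ℂ] complexBetti X 2 →ₗ[ℂ] ℂ), IsFujikiForm n X b →
  ∀ (M : HodgeModel (2 * n) X) (hM : M.IsHodgeSymmetric)
    (T : Type) [AddCommGroup T] [Module ℚ T] (H : HodgeStructure T 2) (P : H.Polarization)
    (hT : H.hodgeNumber 2 0 = 1) (j : H.Hom (bettiTwoHodgeStructureOfModel hX.1 M hM)),
    IsTranscendentalPartHK hX.1 M hM b H P j →
  ∃ W : (H.kugaSatake P hT).SubHodgeStructure, W.toHodgeStructure.IsIrreducible ∧
    ∃ f : W.toHodgeStructure.Hom (bettiThreeTwistOne hX.1 M hM), Function.Injective f.toLinearMap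

/-! ## Thm. 3.2 / O'Grady 2021 Thm. 1.5 — for Kummer type with `ρ = 1`, `KS(H²_tr, q_X) ~ J³(X)⁴` -/

/-- The dimension count behind the exponent: `dim_ℚ C⁺(ℚ⁶) = 2⁵ = 32 = 4 · b₃(Kumⁿ)` (`b₃ = 8`), the
`ℚ`-dimension of `H¹(J³(X)⁴)` — four copies, as in O'Grady's theorem (Voisin's restatement Thm. 3.2 says
"two copies"; module docstring). [cite: OGrady2021KummerTori, Thm. 1.5 and §1.1 (b₃ = 8)] -/
example : 2 ^ (6 - 1) = 4 * 8 := by decide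

/-- **O'Grady 2021, Thm. 1.5, last sentence (REFEREED; = Voisin 2022 Thm. 1.1 (2) / Thm. 3.2): "Let `X` be
a hyperkähler variety of Kummer type, of dimension `2n`, and let `L` be an ample line bundle on `X`. […]
Moreover, th[e] Kuga-Satake variety `KS(X,L)` is isogenous to `J³(X)⁴`"; Voisin: "The Kuga-Satake variety
of `(H²(X,ℚ)_tr, q_X)` [of a projective hyper-Kähler manifold of generalized Kummer deformation type with
`ρ(X) = 1`] is isogenous to a sum of [copies] of `J³(X)`."**  Rendering (module docstring): for `2 ≤ n`,
`X` smooth projective of dimension `2n` of `Kumⁿ`-type, every Fujiki form `b`, Hodge-symmetric model `M`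
and presentation `(T, H, P, j)` of `(H²_tr(X, ℚ), q_X)` with `h^{2,0}(T) = 1` and `dim_ℚ T = 6` (i.e.
`ρ(X) = 1`, where `H²_tr = H²_pr = c₁(L)^⊥` and O'Grady's `KS(X,L)` is the Kuga–Satake variety of
`(H²_tr, q_X)`), the Kuga–Satake Hodge structure on `C⁺(P)` is ISOMORPHIC, as a rational Hodge structure,
to the direct sum of four copies of `H³(X, ℚ)(1) = H¹(J³(X), ℚ)`: a `ℚ`-linear isomorphism
`θ : C⁺(P) ≃ (Fin 4 → H³(X(ℂ); ℚ))` carrying the Kuga–Satake filtration onto that of `HodgeStructure.pi`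
(isogeny of abelian varieties ⟺ isomorphism of rational `H¹`).  Exponent `4` = O'Grady's (primary source);
restricted to `ρ(X) = 1` as in Voisin's Thm. 3.2 (O'Grady's `H²_pr`-statement for `ρ ≥ 2` needs an
`H²_pr`-presentation the tree does not have).  A published THEOREM recorded as a named fact.
[cite: OGrady2021KummerTori, Thm. 1.5 (arXiv:1805.12075 §1.2 p. 3, "KS(X,L) is isogenous to J³(X)⁴") and §1.1 (p. 2)]
[cite: Voisin2022FootnotesOGradyMarkman, Thm. 3.2 and Thm. 1.1 (2) (arXiv:2106.06979 pp. 2, 7)]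
[cite: Floccari2024, §5.2 (after the proof of Thm. 5.4: "the Kuga Satake variety is A⁴ … H¹(A,ℚ) ≅ H³(K,ℚ)")] -/
def OGrady2021_kugaSatake_kummerType_fourthPower_thirdCohomology : Prop :=
  ∀ (n : ℕ) (_ : 2 ≤ n) (X : SchemeOver ℂ) (hX : IsSmoothProjective (2 * n) X),
    IsOfGeneralizedKummerType n X →
  ∀ (b : complexBetti X 2 →ₗ[ℂ] complexBetti X 2 →ₗ[ℂ] ℂ), IsFujikiForm n X b →
  ∀ (M : HodgeModel (2 * n) X) (hM : M.IsHodgeSymmetric)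
    (T : Type) [AddCommGroup T] [Module ℚ T] (H : HodgeStructure T 2) (P : H.Polarization)
    (hT : H.hodgeNumber 2 0 = 1) (j : H.Hom (bettiTwoHodgeStructureOfModel hX M hM)),
    IsTranscendentalPartHK hX M hM b H P j → Module.finrank ℚ T = 6 →
  ∃ θ : CliffordAlgebra.even P.quadraticForm ≃ₗ[ℚ] (Fin 4 → bettiCohomology X 3),
    ∀ p : ℤ, ((H.kugaSatake P hT).F p).map (θ.toLinearMap.baseChange ℂ) =
      (HodgeStructure.pi fun _ : Fin 4 ↦ bettiThreeTwistOne hX M hM).F p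

/-! ## Kernel: the `Kumⁿ` spelling of Thm. 1.3 (2) and the ladder's reading of Thm. 1.3 (2)–(3) -/

/-- Thm. 1.3 (2) at `b₃ = 8` (the `Kumⁿ` value, where `J³(X)` is a FOURFOLD): the Kuga–Satake structure of
`H²_tr` has an irreducible sub-Hodge structure embedding into the `8`-dimensional `H³(X, ℚ)(1)`.
[cite: Voisin2022FootnotesOGradyMarkman, Thm. 1.3 (2)] [cite: OGrady2021KummerTori, §1.1 (b₃ = 8)] -/
theorem Voisin2022_thirdCohomology_kugaSatakeFactor.of_thirdBetti_eq_eight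
    (h : Voisin2022_thirdCohomology_kugaSatakeFactor) {n : ℕ} {X : SchemeOver ℂ}
    (hX : IsProjectiveIrreducibleSymplectic (2 * n) X) (hb₃ : Module.finrank ℂ (complexBetti X 3) = 8)
    {b : complexBetti X 2 →ₗ[ℂ] complexBetti X 2 →ₗ[ℂ] ℂ} (hb : IsFujikiForm n X b)
    (M : HodgeModel (2 * n) X) (hM : M.IsHodgeSymmetric)
    {T : Type} [AddCommGroup T] [Module ℚ T] {H : HodgeStructure T 2} {P : H.Polarization}
    (hT : H.hodgeNumber 2 0 = 1) {j : H.Hom (bettiTwoHodgeStructureOfModel hX.1 M hM)}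
    (hj : IsTranscendentalPartHK hX.1 M hM b H P j) :
    ∃ W : (H.kugaSatake P hT).SubHodgeStructure, W.toHodgeStructure.IsIrreducible ∧
      ∃ f : W.toHodgeStructure.Hom (bettiThreeTwistOne hX.1 M hM), Function.Injective f.toLinearMap :=
  h n X hX (by rw [hb₃]; decide) b hb M hM T H P hT j hj

/-- **The ladder's reading of Thm. 1.3 (2) together with Thm. 3.3** (record
`Voisin2022_thirdBetti_lowerBound` of `IrreducibleSymplecticOddCohomology`): a projective irreducible
symplectic host whose `J³(X)` is an abelian SIXFOLD (`b₃ = 12`) has `b₂ ≤ 7`, AND its `H³(X, ℚ)(1)`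
receives an irreducible sub-Hodge structure of the Kuga–Satake structure of `H²_tr(X)` — the two typed
constraints on a hypothetical "transfer lens for Weil sixfolds" host (rung H2).  Kernel, modulo the two
records. [cite: Voisin2022FootnotesOGradyMarkman, Thm. 1.3 (2)–(3)] -/
theorem Voisin2022_thirdCohomology_kugaSatakeFactor.sixfold_host
    (h : Voisin2022_thirdCohomology_kugaSatakeFactor) (h33 : Voisin2022_thirdBetti_lowerBound)
    {n : ℕ} {X : SchemeOver ℂ} (hX : IsProjectiveIrreducibleSymplectic (2 * n) X)
    (hb₃ : Module.finrank ℂ (complexBetti X 3) = 12)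
    {b : complexBetti X 2 →ₗ[ℂ] complexBetti X 2 →ₗ[ℂ] ℂ} (hb : IsFujikiForm n X b)
    (M : HodgeModel (2 * n) X) (hM : M.IsHodgeSymmetric)
    {T : Type} [AddCommGroup T] [Module ℚ T] {H : HodgeStructure T 2} {P : H.Polarization}
    (hT : H.hodgeNumber 2 0 = 1) {j : H.Hom (bettiTwoHodgeStructureOfModel hX.1 M hM)}
    (hj : IsTranscendentalPartHK hX.1 M hM b H P j) :
    Module.finrank ℂ (complexBetti X 2) ≤ 7 ∧
      ∃ W : (H.kugaSatake P hT).SubHodgeStructure, W.toHodgeStructure.IsIrreducible ∧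
        ∃ f : W.toHodgeStructure.Hom (bettiThreeTwistOne hX.1 M hM), Function.Injective f.toLinearMap :=
  ⟨h33.betti_two_le_seven_of_thirdBetti_eq_twelve hX hb₃,
    h n X hX (by rw [hb₃]; decide) b hb M hM T H P hT j hj⟩

end Literature.AlgebraicGeometry.Hyperkaehler

end
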